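import Literature.Analysis.FluidPDE.TaoAveragedSlotSobolev
import HarnessLib

/-!
# The algebra of slot operators: `m(D)`, `Rot_R`, `Dil_λ` compose to slots

T. Tao, *Finite time blowup for an averaged three-dimensional Navier–Stokes equation*,
J. Amer. Math. Soc. **29** (2016), 601–674 = arXiv:1402.0290v3, §1.1 p. 6 ("Fourier multipliers
of order `0` do not necessarily commute with the rotation operators `Rot_R`, but the group of
rotation operators normalises the algebra `𝓜₀`") and §3.2 p. 16 ("the observation that rotation
and dilation operators normalise `𝓜₀ ⊗ ℂ`", used for the transitivity of complex averaging).
Over the accepted `TaoAveragedSobolev.lean` / `TaoAveragedSlotFourier.lean` /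
`TaoAveragedSlotSobolev.lean`, this file proves the operator identities on `L²(ℝ³; ℂ³)` by which a
composition of two slots `m(D) Rot_R Dil_λ` is again a slot — infrastructure for the named facts
`complexAverage_trans` (§3.2 ¶3) and `basicCascade_of_normalised` (§3.2 ¶2, normalisation) of
`TaoAveragedCascadeSteps.lean`:

* `fourierMultiplier_toLp_comp` — `m₂(D) m₁(D) = (m₂ m₁)(D)` (for genuine `L^∞` symbol functions;
  cf. `fourierMultiplier_fourierMultiplier` of `TaoMultiplierToolkit.lean` for `Lp` classes);
* `dil_fourierMultiplier` — `Dil_λ m(D) = m(λ⁻¹·)(D) Dil_λ` (`λ > 0`);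
* `rot_fourierMultiplier` — `Rot_R m(D) = (m ∘ R⁻¹)(D) Rot_R`;
* `dil_rot` — `Dil_λ Rot_R = Rot_R Dil_λ`; `rot_rot` — `Rot_R Rot_S = Rot_{RS}`;
  `dil_dil` — `Dil_a Dil_b = Dil_{ab}` (`a, b > 0`).

## References

* T. Tao, J. Amer. Math. Soc. 29 (2016), 601–674, §1.1 p. 6, §3.2 p. 16. Key `Tao2016AveragedNS`.
-/

noncomputable section

open MeasureTheory Set Filter FourierTransform
open scoped ENNReal NNReal ComplexConjugate

namespace Literature.Analysis.FluidPDE.Tao2016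

/-- Local notation for physical / frequency space `ℝ³`. -/
local notation "ℝ³" => EuclideanSpace ℝ (Fin 3)
/-- Local notation for the complexified range `ℂ³`. -/
local notation "ℂ³" => EuclideanSpace ℂ (Fin 3)

open FunctionSpaces.EuclideanSpace (complexify complexify_apply)

/-! ### Multipliers compose -/

/-- **`m₂(D) m₁(D) = (m₂ m₁)(D)`** on `L²`. [cite: Tao2016AveragedNS, §3.2 p. 16] -/
theorem fourierMultiplier_toLp_comp {m₁ m₂ : ℝ³ → ℂ} (h₁ : MemLp m₁ ∞ (volume : Measure ℝ³))
    (h₂ : MemLp m₂ ∞ (volume : Measure ℝ³)) (h : MemLp (fun ξ => m₂ ξ * m₁ ξ) ∞ (volume : Measure ℝ³))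
    (f : L2C) :
    fourierMultiplier (h₂.toLp m₂) (fourierMultiplier (h₁.toLp m₁) f) = fourierMultiplier (h.toLp _) f := by
  unfold fourierMultiplier
  rw [fourier_fourierInv_eq]
  congr 1
  apply Lp.ext
  filter_upwards [Lp.coeFn_lpSMul (r := 2) (h₂.toLp m₂) ((h₁.toLp m₁) • (𝓕 f : L2C) : L2C),
    Lp.coeFn_lpSMul (r := 2) (h₁.toLp m₁) (𝓕 f : L2C), Lp.coeFn_lpSMul (r := 2) (h.toLp _) (𝓕 f : L2C),
    h₁.coeFn_toLp, h₂.coeFn_toLp, h.coeFn_toLp] with ξ e1 e2 e3 e4 e5 e6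
  rw [e1, Pi.smul_apply', e2, Pi.smul_apply', e3, Pi.smul_apply', e4, e5, e6, smul_smul]

/-! ### Dilations and rotations commute; rotations and dilations compose -/

/-- **`Dil_λ Rot_R = Rot_R Dil_λ`.** [folklore] -/
theorem dil_rot (c : ℝ) (R : ℝ³ ≃ₗᵢ[ℝ] ℝ³) (f : L2C) : dil c (rot R f) = rot R (dil c f) := by
  rcases eq_or_ne c 0 with rfl | hc
  · simp [dil]
  · have hq : Measure.QuasiMeasurePreserving (fun x : ℝ³ => c • x) volume volume :=
      Measure.quasiMeasurePreserving_smul volume hc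
    have hqR := R.symm.measurePreserving.quasiMeasurePreserving
    apply Lp.ext
    filter_upwards [coeFn_dil hc (rot R f), hq.ae_eq (coeFn_rot R f), coeFn_rot R (dil c f),
      hqR.ae_eq (coeFn_dil hc f)] with x h1 h2 h3 h4
    have h2' : (rot R f : ℝ³ → ℂ³) (c • x) = rotMat R ((f : ℝ³ → ℂ³) (R.symm (c • x))) := h2
    have h4' : (dil c f : ℝ³ → ℂ³) (R.symm x) =
        ((c ^ (3 / 2 : ℝ) : ℝ) : ℂ) • (f : ℝ³ → ℂ³) (c • R.symm x) := h4
    rw [h1, h2', h3, h4', LinearIsometryEquiv.map_smul, ContinuousLinearMap.map_smul]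

/-- `(R S) ⊗ 1 = (R ⊗ 1)(S ⊗ 1)` on `ℂ³`. [folklore] -/
theorem rotMat_trans (S R : ℝ³ ≃ₗᵢ[ℝ] ℝ³) (z : ℂ³) : rotMat (S.trans R) z = rotMat R (rotMat S z) := by
  rw [rotMat, complexifyCLM_eq_re_add_im, rotMat, rotMat, complexifyCLM_eq_re_add_im S.toLinearIsometry.toContinuousLinearMap z,
    map_add, map_smul, rotMat_complexify, rotMat_complexify]
  rfl

/-- **`Rot_R Rot_S = Rot_{RS}`.** [folklore] -/
theorem rot_rot (R S : ℝ³ ≃ₗᵢ[ℝ] ℝ³) (f : L2C) : rot R (rot S f) = rot (S.trans R) f := by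
  have hqR := R.symm.measurePreserving.quasiMeasurePreserving
  apply Lp.ext
  filter_upwards [coeFn_rot R (rot S f), hqR.ae_eq (coeFn_rot S f), coeFn_rot (S.trans R) f]
    with x h1 h2 h3
  have h2' : (rot S f : ℝ³ → ℂ³) (R.symm x) = rotMat S ((f : ℝ³ → ℂ³) (S.symm (R.symm x))) := h2
  rw [h1, h2', h3]
  change rotMat R (rotMat S _) = rotMat (S.trans R) ((f : ℝ³ → ℂ³) ((S.trans R).symm x))
  rw [rotMat_trans]
  rfl

/-- **`Dil_a Dil_b = Dil_{ab}`** for `a, b > 0`. [folklore] -/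
theorem dil_dil {a b : ℝ} (ha : 0 < a) (hb : 0 < b) (f : L2C) : dil a (dil b f) = dil (a * b) f := by
  have hq : Measure.QuasiMeasurePreserving (fun x : ℝ³ => a • x) volume volume :=
    Measure.quasiMeasurePreserving_smul volume ha.ne'
  apply Lp.ext
  filter_upwards [coeFn_dil ha.ne' (dil b f), hq.ae_eq (coeFn_dil hb.ne' f),
    coeFn_dil (mul_pos ha hb).ne' f] with x h1 h2 h3
  have h2' : (dil b f : ℝ³ → ℂ³) (a • x) = ((b ^ (3 / 2 : ℝ) : ℝ) : ℂ) • (f : ℝ³ → ℂ³) (b • a • x) := h2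
  rw [h1, h2', h3, smul_smul, smul_smul, ← Complex.ofReal_mul, ← Real.mul_rpow ha.le hb.le,
    mul_comm b a]

/-! ### Rotations and dilations normalise the multipliers -/

/-- `Dil_{1/λ}(m ĝ) = m(λ⁻¹·)... ` — on the Fourier side: `Dil_{c⁻¹} (m • g) = m(c⁻¹·) • Dil_{c⁻¹} g`. [folklore] -/
theorem dil_inv_smul_symbol {c : ℝ} (hc : 0 < c) {m : ℝ³ → ℂ} (hm : MemLp m ∞ (volume : Measure ℝ³))
    (hmc : MemLp (fun ξ => m (c⁻¹ • ξ)) ∞ (volume : Measure ℝ³)) (g : L2C) :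
    dil c⁻¹ ((hm.toLp m) • g : L2C) = (hmc.toLp _) • dil c⁻¹ g := by
  have hc' : c⁻¹ ≠ 0 := inv_ne_zero hc.ne'
  have hq : Measure.QuasiMeasurePreserving (fun x : ℝ³ => c⁻¹ • x) volume volume :=
    Measure.quasiMeasurePreserving_smul volume hc'
  apply Lp.ext
  filter_upwards [coeFn_dil hc' ((hm.toLp m) • g : L2C), hq.ae_eq (Lp.coeFn_lpSMul (r := 2) (hm.toLp m) g),
    hq.ae_eq hm.coeFn_toLp, Lp.coeFn_lpSMul (r := 2) (hmc.toLp _) (dil c⁻¹ g), hmc.coeFn_toLp,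
    coeFn_dil hc' g] with ξ h1 h2 h3 h4 h5 h6
  have h2' : (((hm.toLp m) • g : L2C) : ℝ³ → ℂ³) (c⁻¹ • ξ) =
      ((hm.toLp m : Lp ℂ ∞ volume) : ℝ³ → ℂ) (c⁻¹ • ξ) • (g : ℝ³ → ℂ³) (c⁻¹ • ξ) := h2
  have h3' : ((hm.toLp m : Lp ℂ ∞ volume) : ℝ³ → ℂ) (c⁻¹ • ξ) = m (c⁻¹ • ξ) := h3
  rw [h1, h2', h3', h4, Pi.smul_apply', h5, h6, smul_comm]

/-- **`Dil_λ m(D) = m(λ⁻¹·)(D) Dil_λ`** (`λ > 0`): dilations normalise `𝓜₀ ⊗ ℂ`. [cite: Tao2016AveragedNS, §3.2 p. 16] -/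
theorem dil_fourierMultiplier {c : ℝ} (hc : 0 < c) {m : ℝ³ → ℂ} (hm : MemLp m ∞ (volume : Measure ℝ³))
    (hmc : MemLp (fun ξ => m (c⁻¹ • ξ)) ∞ (volume : Measure ℝ³)) (f : L2C) :
    dil c (fourierMultiplier (hm.toLp m) f) = fourierMultiplier (hmc.toLp _) (dil c f) := by
  have key : (𝓕 (dil c (fourierMultiplier (hm.toLp m) f)) : L2C) =
      𝓕 (fourierMultiplier (hmc.toLp _) (dil c f)) := by
    rw [fourier_dil _ hc, fourierMultiplier, fourier_fourierInv_eq, fourierMultiplier,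
      fourier_fourierInv_eq, fourier_dil _ hc, dil_inv_smul_symbol hc hm hmc]
  have := congrArg (fun x : L2C => (𝓕⁻ x : L2C)) key
  simpa only [fourierInv_fourier_eq] using this

/-- On the Fourier side: `Rot_R (m • g) = (m ∘ R⁻¹) • Rot_R g`. [folklore] -/
theorem rot_smul_symbol (R : ℝ³ ≃ₗᵢ[ℝ] ℝ³) {m : ℝ³ → ℂ} (hm : MemLp m ∞ (volume : Measure ℝ³))
    (hmR : MemLp (fun ξ => m (R.symm ξ)) ∞ (volume : Measure ℝ³)) (g : L2C) :
    rot R ((hm.toLp m) • g : L2C) = (hmR.toLp _) • rot R g := by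
  have hq := R.symm.measurePreserving.quasiMeasurePreserving
  apply Lp.ext
  filter_upwards [coeFn_rot R ((hm.toLp m) • g : L2C), hq.ae_eq (Lp.coeFn_lpSMul (r := 2) (hm.toLp m) g),
    hq.ae_eq hm.coeFn_toLp, Lp.coeFn_lpSMul (r := 2) (hmR.toLp _) (rot R g), hmR.coeFn_toLp,
    coeFn_rot R g] with ξ h1 h2 h3 h4 h5 h6
  have h2' : (((hm.toLp m) • g : L2C) : ℝ³ → ℂ³) (R.symm ξ) =
      ((hm.toLp m : Lp ℂ ∞ volume) : ℝ³ → ℂ) (R.symm ξ) • (g : ℝ³ → ℂ³) (R.symm ξ) := h2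
  have h3' : ((hm.toLp m : Lp ℂ ∞ volume) : ℝ³ → ℂ) (R.symm ξ) = m (R.symm ξ) := h3
  rw [h1, h2', h3', h4, Pi.smul_apply', h5, h6, map_smul]

/-- **`Rot_R m(D) = (m ∘ R⁻¹)(D) Rot_R`**: "the group of rotation operators normalises the
algebra `𝓜₀`" (Tao p. 6). [cite: Tao2016AveragedNS, §1.1 p. 6] -/
theorem rot_fourierMultiplier (R : ℝ³ ≃ₗᵢ[ℝ] ℝ³) {m : ℝ³ → ℂ} (hm : MemLp m ∞ (volume : Measure ℝ³))
    (hmR : MemLp (fun ξ => m (R.symm ξ)) ∞ (volume : Measure ℝ³)) (f : L2C) :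
    rot R (fourierMultiplier (hm.toLp m) f) = fourierMultiplier (hmR.toLp _) (rot R f) := by
  have key : (𝓕 (rot R (fourierMultiplier (hm.toLp m) f)) : L2C) =
      𝓕 (fourierMultiplier (hmR.toLp _) (rot R f)) := by
    rw [fourier_rot, fourierMultiplier, fourier_fourierInv_eq, fourierMultiplier,
      fourier_fourierInv_eq, fourier_rot, rot_smul_symbol R hm hmR]
  have := congrArg (fun x : L2C => (𝓕⁻ x : L2C)) key
  simpa only [fourierInv_fourier_eq] using this

end Literature.Analysis.FluidPDE.Tao2016
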